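import Summits.ABC.IUTFork.Repair.RH2SigmaHullCut
import Summits.ABC.IUTFork.Repair.RH2SigmaHullRow8
import Summits.ABC.IUTFork.Repair.RHDiffPricedVsSlotReach
import HarnessLib

/-!
# R-H ROUND 2, Q2 «S restricted to Σ» — row 16 «diffpriced» BY CONTAINMENT IN ROW 15 at the genuine bed (seat abc-iut-rh2-q2-hull; hand of record
# for the door p464040 = abc-iut-rh-typ-5, 21:47:48Z «row 16 by containment … AGREED, no rival file»): the uniform-untied stratum, in kernel

PROOF-ONLY file (D-0012: 0 definitions, 0 `Prop` facts; abc-iut cell, rung LADDER-ABC:A2.RESCUE.H; seat abc-iut-rh2-q2-hull gen 0; companions p469248,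
p469830, p470562, p471359, `RH2SigmaHullCut`). TAKES NO SIDE on [IUTchIII] Cor. 3.12 or on any author; the row-16 candidate `RH.DiffPriced.HStarDiffPriced`
(abc-iut-lens-transfer-3 / abc-iut-rp-s2 p458364) and the row-15 window are HYPOTHESIS SHAPES, never asserted; typed ≠ proved; nothing here asserts abc.

WHY A SIDE CONDITION. abc-iut-rh-typ-5's containment p464040 (`DiffPricedVsSlotReach.slotReachWindowK_of_hStarDiffPriced`) reads row 15's dictionary
UNIFORMLY per prime (`e ≡ e_p` at EVERY place over `p`, `B_p ≤ 1`). Unlike row 8's `HBand` (which carries fibre-uniformity in its own statement), the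
different-priced cell `(j²−1)·P_w ≤ j·e_w·d_w` is a statement about the bad place `w` alone, while the window's donor slots range over ALL places
`x ∣ p`: on a fibre mixing ramification types the cell does NOT control the donors. So the honest datum-stratum of row 16 at a genuine bed is the
cell TOGETHER WITH the signed slice's side conditions «uniform ramification over every bad prime, `p ∤ e_w` (tame different), `p` odd, untied type
(a strict minimum `r♯` of `t ↦ p^t − t·e_w` exists, so `B = r♯ ≤ 1` is certified)» — round-1 Σ₁₆ = «HEX: k ≤ 2 on p ∤ e_w, untied» lives inside it.
* §1 `exists_certifiedWindow_of_hStarDiffPriced` — cell + side conditions + integer Kummer orders ⟹ ∃ certified `(n₀ ≡ 1, λ)` with `SlotReachWindowK`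
  at `e = ramIdx` (row 16 ⊆ row 15 at the datum level; arithmetic of p464040 §1: `bandCell_of_tameDiffCell`, `slotCell_of_bandCell`, p461479
  `diffPricedCell_iff_bandTop_of_not_dvd`);
* §2 `pilotKummerCompatHull_chosen_of_hStarDiffPriced` — hence the hSHw body at the certificates' bed; §3 `abc_of_sigma16_v10K_window_szpiroBadBoth` —
  the cut-of-record certificate (generic `abc_of_inSigma_v10K_window_szpiroBadBoth` at this datum class).
[cite: Mochizuki2012, IUTchI Ex. 3.2 (iv) p. 71; IUTchIV Prop. 1.1 p. 9, Prop. 1.2 (i) p. 10] [cite: SerreLocalFields1979, Ch. III §6 Prop. 13]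
[cite: NeukirchANT1999, Ch. II Prop. (5.5)] [cite: DupuyHilado2025, §3.9, §4.9] [claim: Mochizuki2012, status: disputed] for every IUT locution.
-/

noncomputable section

open Set Function
open scoped Pointwise

namespace Summit.ABC.IUTFork.Repair.RH2SigmaHull

open Thm311 Thm311.Real Cor312 Cor312.Setting Cor312Vol Cor312Prov Literature.IUT.LogThetaLattice Literature.IUT.LogVolume
  Literature.IUT.HodgeTheaters Literature.IUT.LogVolume.ThetaData
open Literature.NumberTheory.NumberFields Literature.NumberTheory.GaloisRepresentations.Ultrametric NumberField IsDedekindDomain Metric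
  RHSlotReach RH
open Literature.NumberTheory.DiophantineGeometry.GenEll Summit.ABC.ABC.Theorems

section Genuine

variable {F K Fbar : Type} [Field F] [NumberField F] [Field K] [NumberField K] [Algebra F K] [Field Fbar]
  [Algebra F Fbar] [Algebra K Fbar] {E : WeierstrassCurve F} [E.IsElliptic] {l : ℕ} {Pb : BadPlacePredicates K}
  (D : InitialThetaData F K Fbar E l Pb)

/-! ## §1. Row 16 ⊆ row 15 at the datum level, on the uniform-untied tame-different stratum -/

/-- **ROW 16 ⊆ ROW 15 AT THE DATUM LEVEL, in kernel (uniform-untied tame-different stratum).** At the genuine bed `pilotDataOfK D K` with integer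
Kummer orders `m_q(w) = P_q(w)`: IF abc-iut-lens-transfer-3's `HStarDiffPriced D` holds AND every bad place `w ∣ p` has `p` odd, ramification uniform
over `p` (`e_x = e_w` for all `x ∣ p`), tame different `p ∤ e_w`, and untied type (`∃ r♯, StrictMinPow p e_w r♯`), THEN there is a CERTIFIED window
dictionary (`n₀ ≡ 1`; `λ = −r♯_p/e_p` on bad fibres, `−(⌊e/(p−1)⌋+1)/e` elsewhere) for which abc-iut-lens-wuc-1's slot-reach window holds at `e = ramIdx`,
`mΘ = j²·m_q`. Per bad cell: p461479 `diffPricedCell_iff_bandTop_of_not_dvd` (cell = «`(j²−1)·P ≤ j·(e_w−1)`»), `bandCell_of_tameDiffCell` at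
`B = r♯ ≤ 1` (`strictMinPow_le_one`), `slotCell_of_bandCell`, `clause_iff_uniform`. [cite: Mochizuki2012, IUTchIV Prop. 1.1 p. 9, Prop. 1.2 (i) p. 10]
[cite: SerreLocalFields1979, Ch. III §6 Prop. 13] [claim: Mochizuki2012, status: disputed] -/
theorem exists_certifiedWindow_of_hStarDiffPriced (mq : ∀ pp : Nat.Primes, (thetaIndex (pilotDataOfK D K)).Fibre (.inr pp) → ℤ)
    (hmq : ∀ (pp : Nat.Primes) (w : (thetaIndex (pilotDataOfK D K)).Fibre (.inr pp)), haveI : Fact (pp : ℕ).Prime := ⟨pp.2⟩;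
      placeOf (pilotDataOfK D K) pp.1 w ∈ (pilotDataOfK D K).S →
        (mq pp w : ℝ) = (pilotDataOfK D K).qPilot (placeOf (pilotDataOfK D K) pp.1 w))
    (hside : ∀ (pp : Nat.Primes) (w : (thetaIndex (pilotDataOfK D K)).Fibre (.inr pp)), haveI : Fact (pp : ℕ).Prime := ⟨pp.2⟩;
      placeOf (pilotDataOfK D K) pp.1 w ∈ (pilotDataOfK D K).S →
        2 < (pp : ℕ) ∧
        (∀ x : (thetaIndex (pilotDataOfK D K)).Fibre (.inr pp),
          ramIdx K (placeOf (pilotDataOfK D K) pp.1 x) = ramIdx K (placeOf (pilotDataOfK D K) pp.1 w)) ∧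
        ¬ (pp : ℕ) ∣ ramIdx K (placeOf (pilotDataOfK D K) pp.1 w) ∧
        ∃ r : ℤ, RHHeightClass.StrictMinPow (pp : ℕ) (ramIdx K (placeOf (pilotDataOfK D K) pp.1 w)) r)
    (hH : DiffPriced.HStarDiffPriced D) :
    ∃ (n₀ : ∀ pp : Nat.Primes, (thetaIndex (pilotDataOfK D K)).Fibre (.inr pp) → ℕ)
      (lam : ∀ pp : Nat.Primes, (thetaIndex (pilotDataOfK D K)).Fibre (.inr pp) → ℝ),
      (∀ (pp : Nat.Primes) (x : (thetaIndex (pilotDataOfK D K)).Fibre (.inr pp)), haveI : Fact (pp : ℕ).Prime := ⟨pp.2⟩;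
        ∃ u : kOf (pilotDataOfK D K) pp.1 x,
          ‖u‖ ≤ (pp : ℝ) ^ (-(((n₀ pp x : ℤ) - 1 : ℤ) : ℝ) / (ramIdx K (placeOf (pilotDataOfK D K) pp.1 x) : ℝ)) ∧
            u ∉ (logUnits (kOf (pilotDataOfK D K) pp.1 x) : Set (kOf (pilotDataOfK D K) pp.1 x))) ∧
      (∀ (pp : Nat.Primes) (x : (thetaIndex (pilotDataOfK D K)).Fibre (.inr pp)), haveI : Fact (pp : ℕ).Prime := ⟨pp.2⟩;
        ∃ z ∈ (logUnits (kOf (pilotDataOfK D K) pp.1 x) : Set (kOf (pilotDataOfK D K) pp.1 x)), (pp : ℝ) ^ (lam pp x) ≤ ‖z‖) ∧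
      SlotReachWindowK D (fun pp x => haveI : Fact (pp : ℕ).Prime := ⟨pp.2⟩; ramIdx K (placeOf (pilotDataOfK D K) pp.1 x)) n₀ lam
        (fun pp i w => ((((i : ℕ) : ℤ) + 1) ^ 2) * mq pp w) mq := by
  classical
  haveI hne : ∀ pp : Nat.Primes, Fact (pp : ℕ).Prime := fun pp => ⟨pp.2⟩
  -- bad fibres, their (uniform) ramification, the untied exponent
  set Bad : Nat.Primes → Prop := fun pp => ∃ w : (thetaIndex (pilotDataOfK D K)).Fibre (.inr pp), placeOf (pilotDataOfK D K) pp.1 w ∈ (pilotDataOfK D K).S with hBad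
  set eK : Nat.Primes → ℕ := fun pp => if h : Bad pp then ramIdx K (placeOf (pilotDataOfK D K) pp.1 h.choose) else 1 with heK
  set rK : Nat.Primes → ℤ := fun pp =>
    if h : ∃ r : ℤ, RHHeightClass.StrictMinPow (pp : ℕ) (eK pp) r then h.choose else (eK pp : ℤ) with hrK
  set lam : ∀ pp : Nat.Primes, (thetaIndex (pilotDataOfK D K)).Fibre (.inr pp) → ℝ := fun pp x =>
    if Bad pp then -((rK pp : ℤ) : ℝ) / ((eK pp : ℕ) : ℝ)
    else -(((ramIdx K (placeOf (pilotDataOfK D K) pp.1 x) / ((pp : ℕ) - 1) + 1 : ℕ) : ℝ)) / (ramIdx K (placeOf (pilotDataOfK D K) pp.1 x) : ℝ) with hlam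
  have hodd : ∀ (pp : Nat.Primes) (w : (thetaIndex (pilotDataOfK D K)).Fibre (.inr pp)), placeOf (pilotDataOfK D K) pp.1 w ∈ (pilotDataOfK D K).S → 2 < (pp : ℕ) :=
    fun pp w hw => (hside pp w hw).1
  have hunif : ∀ (pp : Nat.Primes) (w : (thetaIndex (pilotDataOfK D K)).Fibre (.inr pp)), placeOf (pilotDataOfK D K) pp.1 w ∈ (pilotDataOfK D K).S →
      ∀ x : (thetaIndex (pilotDataOfK D K)).Fibre (.inr pp), ramIdx K (placeOf (pilotDataOfK D K) pp.1 x) = eK pp := by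
    intro pp w hw x
    have hB : Bad pp := ⟨w, hw⟩
    have h1 := (hside pp w hw).2.1
    rw [heK]
    dsimp only
    rw [dif_pos hB, h1 x, h1 hB.choose]
  have heK1 : ∀ pp : Nat.Primes, 1 ≤ eK pp := by
    intro pp
    rw [heK]
    dsimp only
    split_ifs
    · exact Nat.one_le_iff_ne_zero.2 (ramIdx_ne_zero K _)
    · exact le_rfl
  have hstrict : ∀ (pp : Nat.Primes) (w : (thetaIndex (pilotDataOfK D K)).Fibre (.inr pp)), placeOf (pilotDataOfK D K) pp.1 w ∈ (pilotDataOfK D K).S →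
      RHHeightClass.StrictMinPow (pp : ℕ) (eK pp) (rK pp) := by
    intro pp w hw
    have hex : ∃ r : ℤ, RHHeightClass.StrictMinPow (pp : ℕ) (eK pp) r := by
      obtain ⟨r, hr⟩ := (hside pp w hw).2.2.2
      rw [hunif pp w hw w] at hr
      exact ⟨r, hr⟩
    rw [hrK]
    dsimp only
    rw [dif_pos hex]
    exact hex.choose_spec
  refine ⟨fun _ _ => 1, lam, fun pp x => ?_, fun pp x => ?_, fun pp i w hw x => ?_⟩
  · -- `n₀ = 1`: an integral non-log-unit ([IUTchIV] Prop. 1.4 (ii))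
    obtain ⟨u, hu, hu'⟩ := exists_norm_le_one_not_mem_logUnits pp.1 (kOf (pilotDataOfK D K) pp.1 x)
    refine ⟨u, ?_, hu'⟩
    have h0 : (-((((1 : ℕ) : ℤ) - 1 : ℤ) : ℝ) / (ramIdx K (placeOf (pilotDataOfK D K) pp.1 x) : ℝ)) = 0 := by norm_num
    rw [h0, Real.rpow_zero]
    exact hu
  · -- the outer radius certificate
    rw [hlam]
    dsimp only
    by_cases hB : Bad pp
    · rw [if_pos hB]
      have hw := hB.choose_spec
      have hc : RHHeightClass.CertVal (pp : ℕ) (ramIdx K (placeOf (pilotDataOfK D K) pp.1 x)) (rK pp) := by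
        rw [hunif pp _ hw x]; exact Or.inl (hstrict pp _ hw)
      have h := RHHeightClassGlue.exists_mem_logUnits_rpow_le_of_certVal (pilotDataOfK D K) pp.1 (hodd pp _ hw) x hc
      rw [hunif pp _ hw x] at h
      exact h
    · rw [if_neg hB]
      exact RHHeightClassGlue.exists_mem_logUnits_rpow_le_div_succ (pilotDataOfK D K) pp.1 x
  · -- the window from the different-priced cells
    have hw' : placeOf (pilotDataOfK D K) pp.1 w ∈ (pilotDataOfK D K).S := hw
    have hB : Bad pp := ⟨w, hw'⟩
    obtain ⟨P, hP, -, -⟩ := exists_nat_qPilot_pilotDataOfK D hw'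
    have hnd' : ¬ (pp : ℕ) ∣ (placeOf (pilotDataOfK D K) pp.1 w).asIdeal.ramificationIdx ℤ := by
      rw [← ramIdx_eq K (placeOf (pilotDataOfK D K) pp.1 w)]; exact (hside pp w hw').2.2.1
    have hcell := (DiffPricedVsTameBand.diffPricedCell_iff_bandTop_of_not_dvd D pp w hnd' hP ((i : ℕ) + 1)).1 (hH pp i w hw')
    rw [← ramIdx_eq K (placeOf (pilotDataOfK D K) pp.1 w), hunif pp w hw' w] at hcell
    have hmqP : mq pp w = (P : ℤ) := by
      have h1 : ((mq pp w : ℤ) : ℝ) = (((P : ℕ) : ℤ) : ℝ) := by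
        rw [hmq pp w hw', hP]
        push_cast
        rfl
      exact_mod_cast h1
    rw [hlam]
    dsimp only
    simp only [if_pos hB, hunif pp w hw']
    rw [clause_iff_uniform (eK pp) (heK1 pp) 1 (rK pp) (i : ℕ) _ (mq pp w)]
    refine RHHeightClassGlue.slotCell_of_bandCell (heK1 pp) le_rfl (i : ℕ) ?_
    rw [hmqP]
    refine DiffPricedVsSlotReach.bandCell_of_tameDiffCell (i : ℕ) (RHHeightClass.strictMinPow_le_one (hstrict pp w hw')) ?_
    push_cast at hcell ⊢
    linarith

/-! ## §2. The certificates' bed: `HStarDiffPriced` + the side conditions ALONE ⟹ the hSHw body -/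

variable (M : Type) [Field M] [NumberField M]
  (archPk : ∀ (j : (thetaIndex (pilotDataOfK D K)).Label) (vQ : (thetaIndex (pilotDataOfK D K)).VQ),
    Set ((logShellsDH (pilotDataOfK D K) (analyticLogv K)).Packet j vQ))
  (archSub : ∀ (j : (thetaIndex (pilotDataOfK D K)).Label) (v : (thetaIndex (pilotDataOfK D K)).V),
    Set ((logShellsDH (pilotDataOfK D K) (analyticLogv K)).Packet j ((thetaIndex (pilotDataOfK D K)).over v)))
  (Ψ : ℤ → ∀ v : (thetaIndex (pilotDataOfK D K)).V, v ∈ (thetaIndex (pilotDataOfK D K)).Vbad →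
    Set ((logShellsDH (pilotDataOfK D K) (analyticLogv K)).StarPacket v))
  (act : ℤ → ∀ v : (thetaIndex (pilotDataOfK D K)).V, v ∈ (thetaIndex (pilotDataOfK D K)).Vbad →
    (logShellsDH (pilotDataOfK D K) (analyticLogv K)).StarPacket v →
      Module.End ℚ ((logShellsDH (pilotDataOfK D K) (analyticLogv K)).StarPacket v))
  (Mmod : ℤ → ∀ j : (thetaIndex (pilotDataOfK D K)).LabelStar, Set ((logShellsDH (pilotDataOfK D K) (analyticLogv K)).GlobalPacket j.1))
  (region : ℤ → ∀ j : (thetaIndex (pilotDataOfK D K)).LabelStar, FinDivisor M → ∀ vQ : (thetaIndex (pilotDataOfK D K)).VQ,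
    Set ((logShellsDH (pilotDataOfK D K) (analyticLogv K)).Packet j.1 vQ))
  (frobAdm : ℤ → ℤ → ∀ (j : (thetaIndex (pilotDataOfK D K)).Label) (vQ : (thetaIndex (pilotDataOfK D K)).VQ),
    Set ((logShellsDH (pilotDataOfK D K) (analyticLogv K)).Packet j vQ) → Prop)
  (frobLogvol : ℤ → ℤ → ∀ (j : (thetaIndex (pilotDataOfK D K)).Label) (vQ : (thetaIndex (pilotDataOfK D K)).VQ),
    Set ((logShellsDH (pilotDataOfK D K) (analyticLogv K)).Packet j vQ) → ℝ)
  (frobΨ : ℤ → ℤ → ∀ v : (thetaIndex (pilotDataOfK D K)).V, v ∈ (thetaIndex (pilotDataOfK D K)).Vbad →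
    Set ((logShellsDH (pilotDataOfK D K) (analyticLogv K)).StarPacket v))
  (frobMmod : ℤ → ℤ → ∀ j : (thetaIndex (pilotDataOfK D K)).LabelStar,
    Set ((logShellsDH (pilotDataOfK D K) (analyticLogv K)).GlobalPacket j.1))
  (unitImage : ℤ → ℤ → ℕ → ∀ (j : (thetaIndex (pilotDataOfK D K)).Label) (vQ : (thetaIndex (pilotDataOfK D K)).VQ),
    Set ((logShellsDH (pilotDataOfK D K) (analyticLogv K)).Packet j vQ))
  (ballImage : ℤ → ℤ → ∀ (j : (thetaIndex (pilotDataOfK D K)).Label) (vQ : (thetaIndex (pilotDataOfK D K)).VQ),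
    Set ((logShellsDH (pilotDataOfK D K) (analyticLogv K)).Packet j vQ))
  (thetaDiv : ℤ → ℤ → LgpDivisor M (thetaIndex (pilotDataOfK D K)).lstar)
  (n : ℤ) {HT : Type} {LogLink : HT → HT → Type} {IsFull : ∀ {s t : HT}, LogLink s t → Prop}
  (lat : LGPGaussianLogThetaLattice LogLink IsFull)
  {Frd : Type} {IsoF : Frd → Frd → Type} {Ob : Frd → Type} {realify : Frd → Frd} {Strip : Type}
  {IsoS : Strip → Strip → Type}
  {Mv : ∀ v : (thetaIndex (pilotDataOfK D K)).V, v ∈ (thetaIndex (pilotDataOfK D K)).Vbad → Type} [∀ v h, Monoid (Mv v h)]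
  (sig : GlobalLGPFrobenioidSignature (thetaIndex (pilotDataOfK D K)).lstar (thetaIndex (pilotDataOfK D K)).V
    (· ∈ (thetaIndex (pilotDataOfK D K)).Vbad) Frd IsoF Ob realify Strip IsoS Mv)
  (split : SplittingMonoids Mv) {ObΔ : Type}
  {N : ∀ v : (thetaIndex (pilotDataOfK D K)).V, v ∈ (thetaIndex (pilotDataOfK D K)).Vbad → Type} [∀ v h, Monoid (N v h)]
  (qData : QPilotData ObΔ N)
  (qK : ∀ v : (thetaIndex (pilotDataOfK D K)).V, v ∈ (thetaIndex (pilotDataOfK D K)).Vbad →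
    Set ((logShellsDH (pilotDataOfK D K) (analyticLogv K)).StarPacket v))

/-- **ROW 16 AT THE CERTIFICATES' BED: `HStarDiffPriced D` + the uniform-untied tame-different side conditions ⟹ the BODY of `hSHw`** (CHOSEN
realising ideles, analytic logarithms; any column binders, any `qK`): §1 at the integer Kummer orders of `exists_intKummerOrders`, then
`pilotKummerCompatHull_chosen_of_slotReachWindowK` (p469830). Every dictionary binder of the round-1 door `RH.DiffPricedDoor` (p460055 / p464040 ∘
p462301) is discharged. [cite: DupuyHilado2025, §3.9, §4.9] [cite: Mochizuki2012, IUTchI Ex. 3.2 (iv) p. 71] [claim: Mochizuki2012, status: disputed] -/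
theorem pilotKummerCompatHull_chosen_of_hStarDiffPriced
    (hside : ∀ (pp : Nat.Primes) (w : (thetaIndex (pilotDataOfK D K)).Fibre (.inr pp)), haveI : Fact (pp : ℕ).Prime := ⟨pp.2⟩;
      placeOf (pilotDataOfK D K) pp.1 w ∈ (pilotDataOfK D K).S →
        2 < (pp : ℕ) ∧
        (∀ x : (thetaIndex (pilotDataOfK D K)).Fibre (.inr pp),
          ramIdx K (placeOf (pilotDataOfK D K) pp.1 x) = ramIdx K (placeOf (pilotDataOfK D K) pp.1 w)) ∧
        ¬ (pp : ℕ) ∣ ramIdx K (placeOf (pilotDataOfK D K) pp.1 w) ∧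
        ∃ r : ℤ, RHHeightClass.StrictMinPow (pp : ℕ) (ramIdx K (placeOf (pilotDataOfK D K) pp.1 w)) r)
    (hH : DiffPriced.HStarDiffPriced D) :
    PilotKummerCompatHull
      (LatticeSituation.ofShells (logShellsDH (pilotDataOfK D K) (analyticLogv K)) M archPk archSub
        (summandPiecesPr (pilotDataOfK D K) (logvAnalytic_analyticLogv (F := K))).Adm
        (summandPiecesPr (pilotDataOfK D K) (logvAnalytic_analyticLogv (F := K))).logvol Ψ act Mmod region frobAdm frobLogvol frobΨ
        frobMmod unitImage ballImage thetaDiv)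
      (settingPrVolSharp (pilotDataOfK D K) (logvAnalytic_analyticLogv (F := K)) M archPk archSub Ψ act Mmod region n lat sig split qData
        (exists_realising_qIdeles_pilotDataOfK D).choose (exists_realising_thetaIdeles_pilotDataOfK D).choose
        (exists_realising_qIdeles_pilotDataOfK D).choose_spec.1 (exists_realising_qIdeles_pilotDataOfK D).choose_spec.2.1)
      (fun _ => (settingPrVolSharp (pilotDataOfK D K) (logvAnalytic_analyticLogv (F := K)) M archPk archSub Ψ act Mmod region n lat sig
        split qData (exists_realising_qIdeles_pilotDataOfK D).choose (exists_realising_thetaIdeles_pilotDataOfK D).choose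
        (exists_realising_qIdeles_pilotDataOfK D).choose_spec.1 (exists_realising_qIdeles_pilotDataOfK D).choose_spec.2.1).qRegion)
      qK := by
  obtain ⟨mq, hmq⟩ := exists_intKummerOrders D
  obtain ⟨n₀, lam, hn₀, hlam, hW⟩ := exists_certifiedWindow_of_hStarDiffPriced D mq hmq hside hH
  exact pilotKummerCompatHull_chosen_of_slotReachWindowK D M archPk archSub Ψ act Mmod region frobAdm frobLogvol frobΨ frobMmod unitImage
    ballImage thetaDiv n lat sig split qData qK n₀ lam mq hn₀ hlam hmq hW

end Genuine

/-! ## §3. The Σ₁₆ cut certificate -/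

section Certificate

/-- **`abc_of_sigma16_v10K_window_szpiroBadBoth` — «S|Σ₁₆ ⟹ abc» in the cut-of-record shape (R-H round 2, Q2 row 16).** The generic cut certificate
`abc_of_inSigma_v10K_window_szpiroBadBoth` at the datum class «uniform-untied tame-different side conditions ∧ `HStarDiffPriced T.D`» with the door §2.
Explicit 3 = Σ₁₆(window ∧ Szpiro-bad) · NUM(deep ∧ Szpiro-bad) · CONE. Whether shallow Szpiro-bad genuine data lie in Σ₁₆ is Q3, NOT claimed.
«`ABC` follows from these hypotheses AS TYPED»; no side taken on [IUTchIII] Cor. 3.12; typed ≠ proved. [claim: Mochizuki2012, status: disputed]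
[cite: Mochizuki2012, IUTchIII Cor. 3.12 p. 173–174; IUTchIV Thm. 1.10 p. 22–23] [cite: DupuyHilado2025, §3.9, §4.9]
**WARNING (abc-iut-rh2-q2-hull gen 2, after referee abc-iut-rh-ref-3's binding kernel caveat): VACUOUS AS TYPED.** The binder `hreg` below (verbatim from
p450130) is KERNEL-REFUTED (`Conditional.not_hreg_v4`), so this kernel-true implication can never be discharged; its honest replacement is the re-cut
(`hreg ↦ hregBad`) `abc_of_sigma16_v10K_window_szpiroBadAll` (`Repair/RH2SigmaHullRecutRows.lean`) / `abc_of_inSigma16_v10K_window_szpiroBadAll`. -/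
theorem abc_of_sigma16_v10K_window_szpiroBadBoth
    (M : ∀ (P : NFPoint) (l : ℕ) (T : Cor22.ThetaVolumeDatumAt P l), Type) [∀ P l T, Field (M P l T)] [∀ P l T, NumberField (M P l T)]
    (archPk : ∀ (P : NFPoint) (l : ℕ) (T : Cor22.ThetaVolumeDatumAt P l), letI := T.instFieldF; letI := T.instNumberFieldF; letI := T.instAlgebraF; letI := T.instFieldK;
        letI := T.instNumberFieldK; letI := T.instAlgebraK; letI := T.instFieldFbar; letI := T.instAlgebraFbar;
        letI := T.instAlgebraKFbar; letI := T.instIsElliptic;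
      ∀ (j : (thetaIndex (pilotDataOfK T.D T.K)).Label) (vQ : (thetaIndex (pilotDataOfK T.D T.K)).VQ), Set ((logShellsDH (pilotDataOfK T.D T.K) (analyticLogv T.K)).Packet j vQ))
    (archSub : ∀ (P : NFPoint) (l : ℕ) (T : Cor22.ThetaVolumeDatumAt P l), letI := T.instFieldF; letI := T.instNumberFieldF; letI := T.instAlgebraF; letI := T.instFieldK;
        letI := T.instNumberFieldK; letI := T.instAlgebraK; letI := T.instFieldFbar; letI := T.instAlgebraFbar;
        letI := T.instAlgebraKFbar; letI := T.instIsElliptic;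
      ∀ (j : (thetaIndex (pilotDataOfK T.D T.K)).Label) (v : (thetaIndex (pilotDataOfK T.D T.K)).V), Set ((logShellsDH (pilotDataOfK T.D T.K) (analyticLogv T.K)).Packet j ((thetaIndex (pilotDataOfK T.D T.K)).over v)))
    (Ψ : ∀ (P : NFPoint) (l : ℕ) (T : Cor22.ThetaVolumeDatumAt P l), letI := T.instFieldF; letI := T.instNumberFieldF; letI := T.instAlgebraF; letI := T.instFieldK;
        letI := T.instNumberFieldK; letI := T.instAlgebraK; letI := T.instFieldFbar; letI := T.instAlgebraFbar;
        letI := T.instAlgebraKFbar; letI := T.instIsElliptic;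
      ℤ → ∀ v : (thetaIndex (pilotDataOfK T.D T.K)).V, v ∈ (thetaIndex (pilotDataOfK T.D T.K)).Vbad → Set ((logShellsDH (pilotDataOfK T.D T.K) (analyticLogv T.K)).StarPacket v))
    (act : ∀ (P : NFPoint) (l : ℕ) (T : Cor22.ThetaVolumeDatumAt P l), letI := T.instFieldF; letI := T.instNumberFieldF; letI := T.instAlgebraF; letI := T.instFieldK;
        letI := T.instNumberFieldK; letI := T.instAlgebraK; letI := T.instFieldFbar; letI := T.instAlgebraFbar;
        letI := T.instAlgebraKFbar; letI := T.instIsElliptic;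
      ℤ → ∀ v : (thetaIndex (pilotDataOfK T.D T.K)).V, v ∈ (thetaIndex (pilotDataOfK T.D T.K)).Vbad → (logShellsDH (pilotDataOfK T.D T.K) (analyticLogv T.K)).StarPacket v → Module.End ℚ ((logShellsDH (pilotDataOfK T.D T.K) (analyticLogv T.K)).StarPacket v))
    (Mmod : ∀ (P : NFPoint) (l : ℕ) (T : Cor22.ThetaVolumeDatumAt P l), letI := T.instFieldF; letI := T.instNumberFieldF; letI := T.instAlgebraF; letI := T.instFieldK;
        letI := T.instNumberFieldK; letI := T.instAlgebraK; letI := T.instFieldFbar; letI := T.instAlgebraFbar;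
        letI := T.instAlgebraKFbar; letI := T.instIsElliptic;
      ℤ → ∀ j : (thetaIndex (pilotDataOfK T.D T.K)).LabelStar, Set ((logShellsDH (pilotDataOfK T.D T.K) (analyticLogv T.K)).GlobalPacket j.1))
    (region : ∀ (P : NFPoint) (l : ℕ) (T : Cor22.ThetaVolumeDatumAt P l), letI := T.instFieldF; letI := T.instNumberFieldF; letI := T.instAlgebraF; letI := T.instFieldK;
        letI := T.instNumberFieldK; letI := T.instAlgebraK; letI := T.instFieldFbar; letI := T.instAlgebraFbar;
        letI := T.instAlgebraKFbar; letI := T.instIsElliptic;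
      ℤ → ∀ j : (thetaIndex (pilotDataOfK T.D T.K)).LabelStar, FinDivisor (M P l T) → ∀ vQ : (thetaIndex (pilotDataOfK T.D T.K)).VQ, Set ((logShellsDH (pilotDataOfK T.D T.K) (analyticLogv T.K)).Packet j.1 vQ))
    (frobAdm : ∀ (P : NFPoint) (l : ℕ) (T : Cor22.ThetaVolumeDatumAt P l), letI := T.instFieldF; letI := T.instNumberFieldF; letI := T.instAlgebraF; letI := T.instFieldK;
        letI := T.instNumberFieldK; letI := T.instAlgebraK; letI := T.instFieldFbar; letI := T.instAlgebraFbar;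
        letI := T.instAlgebraKFbar; letI := T.instIsElliptic;
      ℤ → ℤ → ∀ (j : (thetaIndex (pilotDataOfK T.D T.K)).Label) (vQ : (thetaIndex (pilotDataOfK T.D T.K)).VQ), Set ((logShellsDH (pilotDataOfK T.D T.K) (analyticLogv T.K)).Packet j vQ) → Prop)
    (frobLogvol : ∀ (P : NFPoint) (l : ℕ) (T : Cor22.ThetaVolumeDatumAt P l), letI := T.instFieldF; letI := T.instNumberFieldF; letI := T.instAlgebraF; letI := T.instFieldK;
        letI := T.instNumberFieldK; letI := T.instAlgebraK; letI := T.instFieldFbar; letI := T.instAlgebraFbar;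
        letI := T.instAlgebraKFbar; letI := T.instIsElliptic;
      ℤ → ℤ → ∀ (j : (thetaIndex (pilotDataOfK T.D T.K)).Label) (vQ : (thetaIndex (pilotDataOfK T.D T.K)).VQ), Set ((logShellsDH (pilotDataOfK T.D T.K) (analyticLogv T.K)).Packet j vQ) → ℝ)
    (frobΨ : ∀ (P : NFPoint) (l : ℕ) (T : Cor22.ThetaVolumeDatumAt P l), letI := T.instFieldF; letI := T.instNumberFieldF; letI := T.instAlgebraF; letI := T.instFieldK;
        letI := T.instNumberFieldK; letI := T.instAlgebraK; letI := T.instFieldFbar; letI := T.instAlgebraFbar;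
        letI := T.instAlgebraKFbar; letI := T.instIsElliptic;
      ℤ → ℤ → ∀ v : (thetaIndex (pilotDataOfK T.D T.K)).V, v ∈ (thetaIndex (pilotDataOfK T.D T.K)).Vbad → Set ((logShellsDH (pilotDataOfK T.D T.K) (analyticLogv T.K)).StarPacket v))
    (frobMmod : ∀ (P : NFPoint) (l : ℕ) (T : Cor22.ThetaVolumeDatumAt P l), letI := T.instFieldF; letI := T.instNumberFieldF; letI := T.instAlgebraF; letI := T.instFieldK;
        letI := T.instNumberFieldK; letI := T.instAlgebraK; letI := T.instFieldFbar; letI := T.instAlgebraFbar;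
        letI := T.instAlgebraKFbar; letI := T.instIsElliptic;
      ℤ → ℤ → ∀ j : (thetaIndex (pilotDataOfK T.D T.K)).LabelStar, Set ((logShellsDH (pilotDataOfK T.D T.K) (analyticLogv T.K)).GlobalPacket j.1))
    (unitImage : ∀ (P : NFPoint) (l : ℕ) (T : Cor22.ThetaVolumeDatumAt P l), letI := T.instFieldF; letI := T.instNumberFieldF; letI := T.instAlgebraF; letI := T.instFieldK;
        letI := T.instNumberFieldK; letI := T.instAlgebraK; letI := T.instFieldFbar; letI := T.instAlgebraFbar;
        letI := T.instAlgebraKFbar; letI := T.instIsElliptic;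
      ℤ → ℤ → ℕ → ∀ (j : (thetaIndex (pilotDataOfK T.D T.K)).Label) (vQ : (thetaIndex (pilotDataOfK T.D T.K)).VQ), Set ((logShellsDH (pilotDataOfK T.D T.K) (analyticLogv T.K)).Packet j vQ))
    (ballImage : ∀ (P : NFPoint) (l : ℕ) (T : Cor22.ThetaVolumeDatumAt P l), letI := T.instFieldF; letI := T.instNumberFieldF; letI := T.instAlgebraF; letI := T.instFieldK;
        letI := T.instNumberFieldK; letI := T.instAlgebraK; letI := T.instFieldFbar; letI := T.instAlgebraFbar;
        letI := T.instAlgebraKFbar; letI := T.instIsElliptic;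
      ℤ → ℤ → ∀ (j : (thetaIndex (pilotDataOfK T.D T.K)).Label) (vQ : (thetaIndex (pilotDataOfK T.D T.K)).VQ), Set ((logShellsDH (pilotDataOfK T.D T.K) (analyticLogv T.K)).Packet j vQ))
    (thetaDiv : ∀ (P : NFPoint) (l : ℕ) (T : Cor22.ThetaVolumeDatumAt P l), letI := T.instFieldF; letI := T.instNumberFieldF; letI := T.instAlgebraF; letI := T.instFieldK;
        letI := T.instNumberFieldK; letI := T.instAlgebraK; letI := T.instFieldFbar; letI := T.instAlgebraFbar;
        letI := T.instAlgebraKFbar; letI := T.instIsElliptic;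
      ℤ → ℤ → LgpDivisor (M P l T) (thetaIndex (pilotDataOfK T.D T.K)).lstar)
    (n : ∀ (P : NFPoint) (l : ℕ) (T : Cor22.ThetaVolumeDatumAt P l), ℤ)
    {HT : ∀ (P : NFPoint) (l : ℕ) (T : Cor22.ThetaVolumeDatumAt P l), Type} {LogLink : ∀ (P : NFPoint) (l : ℕ) (T : Cor22.ThetaVolumeDatumAt P l), HT P l T → HT P l T → Type}
    {IsFull : ∀ (P : NFPoint) (l : ℕ) (T : Cor22.ThetaVolumeDatumAt P l), ∀ {s t : HT P l T}, LogLink P l T s t → Prop}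
    (lat : ∀ (P : NFPoint) (l : ℕ) (T : Cor22.ThetaVolumeDatumAt P l), LGPGaussianLogThetaLattice (LogLink P l T) (IsFull P l T))
    {Frd : ∀ (P : NFPoint) (l : ℕ) (T : Cor22.ThetaVolumeDatumAt P l), Type} {IsoF : ∀ (P : NFPoint) (l : ℕ) (T : Cor22.ThetaVolumeDatumAt P l), Frd P l T → Frd P l T → Type} {Ob : ∀ (P : NFPoint) (l : ℕ) (T : Cor22.ThetaVolumeDatumAt P l), Frd P l T → Type}
    {realify : ∀ (P : NFPoint) (l : ℕ) (T : Cor22.ThetaVolumeDatumAt P l), Frd P l T → Frd P l T} {Strip : ∀ (P : NFPoint) (l : ℕ) (T : Cor22.ThetaVolumeDatumAt P l), Type} {IsoS : ∀ (P : NFPoint) (l : ℕ) (T : Cor22.ThetaVolumeDatumAt P l), Strip P l T → Strip P l T → Type}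
    {Mv : ∀ (P : NFPoint) (l : ℕ) (T : Cor22.ThetaVolumeDatumAt P l), letI := T.instFieldF; letI := T.instNumberFieldF; letI := T.instAlgebraF; letI := T.instFieldK;
        letI := T.instNumberFieldK; letI := T.instAlgebraK; letI := T.instFieldFbar; letI := T.instAlgebraFbar;
        letI := T.instAlgebraKFbar; letI := T.instIsElliptic;
      ∀ v : (thetaIndex (pilotDataOfK T.D T.K)).V, v ∈ (thetaIndex (pilotDataOfK T.D T.K)).Vbad → Type}
    [∀ P l T v h, Monoid (Mv P l T v h)]
    (sig : ∀ (P : NFPoint) (l : ℕ) (T : Cor22.ThetaVolumeDatumAt P l), letI := T.instFieldF; letI := T.instNumberFieldF; letI := T.instAlgebraF; letI := T.instFieldK;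
        letI := T.instNumberFieldK; letI := T.instAlgebraK; letI := T.instFieldFbar; letI := T.instAlgebraFbar;
        letI := T.instAlgebraKFbar; letI := T.instIsElliptic;
      GlobalLGPFrobenioidSignature (thetaIndex (pilotDataOfK T.D T.K)).lstar (thetaIndex (pilotDataOfK T.D T.K)).V (· ∈ (thetaIndex (pilotDataOfK T.D T.K)).Vbad) (Frd P l T) (IsoF P l T) (Ob P l T) (realify P l T)
        (Strip P l T) (IsoS P l T) (Mv P l T))
    (split : ∀ (P : NFPoint) (l : ℕ) (T : Cor22.ThetaVolumeDatumAt P l), SplittingMonoids (Mv P l T))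
    {ObΔ : ∀ (P : NFPoint) (l : ℕ) (T : Cor22.ThetaVolumeDatumAt P l), Type} {N : ∀ (P : NFPoint) (l : ℕ) (T : Cor22.ThetaVolumeDatumAt P l), letI := T.instFieldF; letI := T.instNumberFieldF; letI := T.instAlgebraF; letI := T.instFieldK;
        letI := T.instNumberFieldK; letI := T.instAlgebraK; letI := T.instFieldFbar; letI := T.instAlgebraFbar;
        letI := T.instAlgebraKFbar; letI := T.instIsElliptic;
      ∀ v : (thetaIndex (pilotDataOfK T.D T.K)).V, v ∈ (thetaIndex (pilotDataOfK T.D T.K)).Vbad → Type}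
    [∀ P l T v h, Monoid (N P l T v h)] (qData : ∀ (P : NFPoint) (l : ℕ) (T : Cor22.ThetaVolumeDatumAt P l), QPilotData (ObΔ P l T) (N P l T))
    (qK : ∀ (P : NFPoint) (l : ℕ) (T : Cor22.ThetaVolumeDatumAt P l), letI := T.instFieldF; letI := T.instNumberFieldF; letI := T.instAlgebraF; letI := T.instFieldK;
        letI := T.instNumberFieldK; letI := T.instAlgebraK; letI := T.instFieldFbar; letI := T.instAlgebraFbar;
        letI := T.instAlgebraKFbar; letI := T.instIsElliptic;
      ∀ v : (thetaIndex (pilotDataOfK T.D T.K)).V, v ∈ (thetaIndex (pilotDataOfK T.D T.K)).Vbad → Set ((logShellsDH (pilotDataOfK T.D T.K) (analyticLogv T.K)).StarPacket v))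
    -- [S_H, WINDOW ∧ SZPIRO-BAD] the hull-level clause (chosen realising ideles / pinned reading), ONLY at admissible data OFF the depth locus of SZPIRO-BAD points
    -- [Σ₁₆, WINDOW ∧ SZPIRO-BAD] the different-priced cells + the uniform-untied tame-different side conditions at every admissible datum
    -- off the depth locus of a Szpiro-bad point
    (hSigma16Bad : ∀ (P : NFPoint), P ∈ UP → ∀ (l : ℕ), l.Prime → 5 ≤ l →
      Cor22.AdmitsCore P → Cor22.CondP2 P l → Cor22.CondP5 P l → Cor22.CondP6 P l →
      -- ONLY at SZPIRO-BAD `(P, l)`: elsewhere `T.Cor312Of` is the theorem `Cor22.ThetaVolumeDatumAt.cor312Of_of_szpiro` (abc-iut-c312-d1)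
      (((l : ℝ) + 5) / 4 < (Cor22.dmod P : ℝ) ∨
        6 * l * (((l : ℝ) + 5) - 4 * Cor22.dmod P) / (((l : ℝ) + 4) * ((l : ℝ) - 3))
            * (P.logDiff + (1 - 1 / (l : ℝ)) * Cor22.logCondAvoid P {2, l})
          + 6 * l * ((l : ℝ) + 5) / (((l : ℝ) + 4) * ((l : ℝ) - 3)) * Real.log Real.pi < Cor22.logQAvoid P {2, l}) →
      ∀ (T : Cor22.ThetaVolumeDatumAt P l), letI := T.instFieldF; letI := T.instNumberFieldF; letI := T.instAlgebraF; letI := T.instFieldK;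
        letI := T.instNumberFieldK; letI := T.instAlgebraK; letI := T.instFieldFbar; letI := T.instAlgebraFbar;
        letI := T.instAlgebraKFbar; letI := T.instIsElliptic;
      ¬ (∃ (pp : Nat.Primes) (_ : 2 < (pp : ℕ)) (i : Fin (thetaIndex (pilotDataOfK T.D T.K)).lstar)
          (x₀ : (thetaIndex (pilotDataOfK T.D T.K)).Fibre (.inr pp)),
        haveI : Fact (pp : ℕ).Prime := ⟨pp.2⟩
        ((pp : ℕ) : ℝ) ^ ((((i : ℕ) : ℝ) + 2) * (4 + 2 * Real.logb (pp : ℕ) (Module.finrank ℚ T.K)) + 1) *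
          ‖(exists_realising_qIdeles_pilotDataOfK T.D).choose pp x₀‖ ^ (((i : ℕ) + 1) ^ 2 - 1) < 1) →
      (∀ (pp : Nat.Primes) (w : (thetaIndex (pilotDataOfK T.D T.K)).Fibre (.inr pp)), haveI : Fact (pp : ℕ).Prime := ⟨pp.2⟩;
        placeOf (pilotDataOfK T.D T.K) pp.1 w ∈ (pilotDataOfK T.D T.K).S →
          2 < (pp : ℕ) ∧
          (∀ x : (thetaIndex (pilotDataOfK T.D T.K)).Fibre (.inr pp),
            ramIdx T.K (placeOf (pilotDataOfK T.D T.K) pp.1 x) = ramIdx T.K (placeOf (pilotDataOfK T.D T.K) pp.1 w)) ∧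
          ¬ (pp : ℕ) ∣ ramIdx T.K (placeOf (pilotDataOfK T.D T.K) pp.1 w) ∧
          ∃ r : ℤ, RHHeightClass.StrictMinPow (pp : ℕ) (ramIdx T.K (placeOf (pilotDataOfK T.D T.K) pp.1 w)) r) ∧
      DiffPriced.HStarDiffPriced T.D)
    (hNumBad : ∀ (P : NFPoint), P ∈ UP → ∀ (l : ℕ), l.Prime → 5 ≤ l →
      Cor22.AdmitsCore P → Cor22.CondP2 P l → Cor22.CondP5 P l → Cor22.CondP6 P l →
      -- ONLY at SZPIRO-BAD `(P, l)`: elsewhere `T.Cor312Of` is the theorem `Cor22.ThetaVolumeDatumAt.cor312Of_of_szpiro` (abc-iut-c312-d1)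
      (((l : ℝ) + 5) / 4 < (Cor22.dmod P : ℝ) ∨
        6 * l * (((l : ℝ) + 5) - 4 * Cor22.dmod P) / (((l : ℝ) + 4) * ((l : ℝ) - 3))
            * (P.logDiff + (1 - 1 / (l : ℝ)) * Cor22.logCondAvoid P {2, l})
          + 6 * l * ((l : ℝ) + 5) / (((l : ℝ) + 4) * ((l : ℝ) - 3)) * Real.log Real.pi < Cor22.logQAvoid P {2, l}) →
      ∀ (T : Cor22.ThetaVolumeDatumAt P l), letI := T.instFieldF; letI := T.instNumberFieldF; letI := T.instAlgebraF; letI := T.instFieldK;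
        letI := T.instNumberFieldK; letI := T.instAlgebraK; letI := T.instFieldFbar; letI := T.instAlgebraFbar;
        letI := T.instAlgebraKFbar; letI := T.instIsElliptic;
      (∃ (pp : Nat.Primes) (_ : 2 < (pp : ℕ)) (i : Fin (thetaIndex (pilotDataOfK T.D T.K)).lstar)
          (x₀ : (thetaIndex (pilotDataOfK T.D T.K)).Fibre (.inr pp)),
        haveI : Fact (pp : ℕ).Prime := ⟨pp.2⟩
        ((pp : ℕ) : ℝ) ^ ((((i : ℕ) : ℝ) + 2) * (4 + 2 * Real.logb (pp : ℕ) (Module.finrank ℚ T.K)) + 1) *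
          ‖(exists_realising_qIdeles_pilotDataOfK T.D).choose pp x₀‖ ^ (((i : ℕ) + 1) ^ 2 - 1) < 1) → T.Cor312Of)
    (hreg : ∀ P : NFPoint, P ∈ UP → ∀ l : ℕ, l.Prime → 5 ≤ l →
      Cor22.AdmitsCore P → Cor22.CondP2 P l → Cor22.CondP5 P l → Cor22.CondP6 P l →
      ∀ T : Cor22.ThetaVolumeDatumAt P l,
        (letI := T.instFieldF; letI := T.instNumberFieldF; letI := T.instAlgebraF; letI := T.instFieldK
         letI := T.instNumberFieldK; letI := T.instAlgebraK; letI := T.instFieldFbar; letI := T.instAlgebraFbar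
         letI := T.instAlgebraKFbar; letI := T.instIsElliptic
         ¬ (∀ p ∈ T.I.supportPrimes, ∀ v w : placesOver (fieldOfModuli T.E) p,
            (Summit.ABC.IUTFork.DHData.ofInput T.I).logQloc p v = (Summit.ABC.IUTFork.DHData.ofInput T.I).logQloc p w)) →
        T.HullEstimateOf
          (((l : ℝ) + 1) / 4 *
            ((1 + 12 * (Cor22.dmod P : ℝ) / l) * (P.logDiff + Cor22.logCondAvoid P {2, l})
              + 2 * Real.log l + 52
              + 20 / 3 * Real.log (((2 ^ 12 * 3 ^ 3 * 5 * Cor22.dmod P : ℕ) : ℝ) * (l : ℝ))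
                * (Nat.primeCounting (2 ^ 12 * 3 ^ 3 * 5 * Cor22.dmod P * l) : ℝ))))
    : _root_.ABC :=
  abc_of_inSigma_v10K_window_szpiroBadBoth (M := M) (archPk := archPk) (archSub := archSub) (Ψ := Ψ) (act := act) (Mmod := Mmod)
    (region := region) (frobAdm := frobAdm) (frobLogvol := frobLogvol) (frobΨ := frobΨ) (frobMmod := frobMmod) (unitImage := unitImage)
    (ballImage := ballImage) (thetaDiv := thetaDiv) (n := n) (lat := lat) (sig := sig) (split := split) (qData := qData) (qK := qK)
    (hNumBad := hNumBad) (hreg := hreg) (hSigmaBad := hSigma16Bad)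
    (hdoor := fun P l T h => by
      letI := T.instFieldF; letI := T.instNumberFieldF; letI := T.instAlgebraF; letI := T.instFieldK
      letI := T.instNumberFieldK; letI := T.instAlgebraK; letI := T.instFieldFbar; letI := T.instAlgebraFbar
      letI := T.instAlgebraKFbar; letI := T.instIsElliptic
      exact pilotKummerCompatHull_chosen_of_hStarDiffPriced T.D (M P l T) (archPk P l T) (archSub P l T) (Ψ P l T) (act P l T)
        (Mmod P l T) (region P l T) (frobAdm P l T) (frobLogvol P l T) (frobΨ P l T) (frobMmod P l T) (unitImage P l T) (ballImage P l T)
        (thetaDiv P l T) (n P l T) (lat P l T) (sig P l T) (split P l T) (qData P l T) (qK P l T) h.1 h.2)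

end Certificate

end Summit.ABC.IUTFork.Repair.RH2SigmaHull

end
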